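/-
B2b (LevelGradedCohnUmans, decidable (m,k) = (2,1) cell) — gen 17.
**Frobenius on the Singer cycle; the non-split image law.**

VALUE = THEOREM (unconditional, all odd `p`), NOT summit progress; the crux item
`SubgroupIdentityDesigns` is untouched and remains open.
Report: `run/shared/lean/b2b/levelgraded-cu/ORACLE-g17.md` §G17-5 (S-g).
-/
import Mathlib
import Summits.MatrixMultiplication.MatrixMultiplication.Theorems.SubgroupIdentityDesigns.Negative.SingerCycleOrder
import Summits.MatrixMultiplication.MatrixMultiplication.Theorems.SubgroupIdentityDesigns.Negative.PfreeAlgebra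

/-!
# Frobenius on the Singer cycle and the non-split image law

After `ExceptionalParity.dickson_sharp`, a `p`-free member `H` of a level-one witness that does
not contain `-1` is conjugate into the monomial group `N(T_s)` (split type) or into the
normaliser `N(C)` of a Singer cycle (non-split type).  This file treats the non-split type in
terms of the scalar part `S_H = scalarHom⁻¹(H)`:

* `frobenius_pow`, `frobenius_singerPlus` — for a shape⁺ element `r = x + y√n` (`n` a
  non-square, `p ≠ 2`) one has `r^p = x - y√n` (Frobenius in `𝔽_p[S]`, `S² = n`, Euler's
  criterion `n^((p-1)/2) = -1`), so `r^(p+1) = x² - n y²` is SCALAR;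
* `card_le_two_mul_scalar_of_conj_singerNormal` — NON-SPLIT LAW for `p + 1 = 2^k`
  (e.g. `p = 31`): if `-1 ∉ H` then `|H| ≤ 2 |S_H|`, i.e. the projective image of `H` has order
  `≤ 2`.  (The shape⁺ part `R` of the conjugate has odd order — the Singer cycle has the unique
  involution `-1` — while its projective image has exponent dividing `p + 1 = 2^k`, hence is a
  `2`-group, hence trivial.)

Companion file `MonomialRatio` treats the split type.
-/

set_option linter.dupNamespace false

noncomputable section

open scoped Classical
open Summit.MatrixMultiplication.MatrixMultiplication.Theorems.LieRankDesigns.Negative (GLm Mat)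
open Literature.NumberTheory.EllipticCurves.BinaryQuartic (two_ne_zero_zmod)

namespace Summit.MatrixMultiplication.MatrixMultiplication.Theorems.SubgroupIdentityDesigns.Negative

section SingerFrobenius

variable {p : ℕ} [hp : Fact p.Prime]

/-! ## Conjugation bookkeeping -/

/-- The scalar part is invariant under conjugation. -/
theorem comap_scalarHom_map_conj (H : Subgroup (GLm p 2)) (g : GLm p 2) :
    (H.map (MulAut.conj g).toMonoidHom).comap (scalarHom p 2) = H.comap (scalarHom p 2) := by
  ext u
  rw [Subgroup.mem_comap, Subgroup.mem_comap, mem_map_conj_iff', mul_assoc, scalarHom_comm,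
    ← mul_assoc, inv_mul_cancel, one_mul]

/-- `-1 ∉ H` is invariant under conjugation. -/
theorem neg_one_not_mem_map_conj {H : Subgroup (GLm p 2)} (g : GLm p 2)
    (hneg : scalarHom p 2 (-1) ∉ H) : scalarHom p 2 (-1) ∉ H.map (MulAut.conj g).toMonoidHom := by
  intro hm
  have h := (comap_scalarHom_map_conj H g).le (show (-1 : (ZMod p)ˣ) ∈ _ from hm)
  exact hneg h

/-! ## Frobenius on the Singer cycle -/

/-- The companion matrix `S = [[0, n],[1, 0]]` of `X² - n`. -/
def singerMat (n : ZMod p) : Mat p 2 := !![0, n; 1, 0]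

/-- `S² = n`. -/
theorem singerMat_sq (n : ZMod p) : singerMat n * singerMat n = n • (1 : Mat p 2) := by
  ext i j
  fin_cases i <;> fin_cases j <;> simp [singerMat, Matrix.mul_apply, Fin.sum_univ_two]

/-- Odd powers of `S`: `S^(2j+1) = n^j S`. -/
theorem singerMat_pow_odd (n : ZMod p) (j : ℕ) :
    singerMat n ^ (2 * j + 1) = (n ^ j) • singerMat n := by
  induction j with
  | zero => simp
  | succ j ih =>
    rw [show 2 * (j + 1) + 1 = (2 * j + 1) + 1 + 1 by ring, pow_succ, pow_succ, ih, smul_mul_assoc,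
      smul_mul_assoc, singerMat_sq, smul_mul_assoc, one_mul, smul_smul, ← pow_succ]

/-- A shape⁺ matrix is `x·1 + y·S`. -/
theorem singerPlus_decomp {n : ZMod p} {r : GLm p 2} (hr : IsSingerPlus n r) :
    (r : Mat p 2) = (r : Mat p 2) 0 0 • (1 : Mat p 2) + (r : Mat p 2) 1 0 • singerMat n := by
  obtain ⟨r01, r11⟩ := hr
  ext i j
  fin_cases i <;> fin_cases j <;> simp [singerMat, r01, r11, mul_comm]

/-- **Frobenius**: `(x·1 + y·S)^p = x·1 - y·S` for `n` a non-square, `p ≠ 2`. -/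
theorem frobenius_pow (hp2 : p ≠ 2) {n : ZMod p} (hn : ∀ x : ZMod p, x * x ≠ n) (x y : ZMod p) :
    (x • (1 : Mat p 2) + y • singerMat n) ^ p = x • (1 : Mat p 2) - y • singerMat n := by
  have hc : Commute (x • (1 : Mat p 2)) (y • singerMat n) :=
    ((Commute.one_left (singerMat n)).smul_left x).smul_right y
  rw [add_pow_char_of_commute p hc, smul_pow, smul_pow, one_pow, ZMod.pow_card,
    ZMod.pow_card]
  -- S^p = -S
  have hodd : p % 2 = 1 := Nat.odd_iff.mp (hp.out.odd_of_ne_two hp2)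
  have hp' : p = 2 * (p / 2) + 1 := by omega
  have hn0 : n ≠ 0 := fun h => hn 0 (by rw [h, mul_zero])
  have hns : ¬ IsSquare n := by
    rintro ⟨r, hr⟩
    exact hn r hr.symm
  have heuler : n ^ (p / 2) = -1 :=
    (ZMod.pow_div_two_eq_neg_one_or_one p hn0).resolve_left
      (fun h => hns ((ZMod.euler_criterion p hn0).mpr h))
  have hSp : singerMat n ^ p = n ^ (p / 2) • singerMat n := by
    have h := singerMat_pow_odd n (p / 2)
    rwa [← hp'] at h
  rw [hSp, heuler, smul_smul, mul_neg_one, neg_smul, sub_eq_add_neg]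

/-- **`r^(p+1)` is scalar** for `r` in the Singer cycle (`n` a non-square, `p ≠ 2`). -/
theorem frobenius_singerPlus (hp2 : p ≠ 2) {n : ZMod p} (hn : ∀ x : ZMod p, x * x ≠ n)
    {r : GLm p 2} (hr : IsSingerPlus n r) : r ^ (p + 1) ∈ (scalarHom p 2).range := by
  set x := (r : Mat p 2) 0 0 with hx
  set y := (r : Mat p 2) 1 0 with hy
  have hdec := singerPlus_decomp hr
  have hpow : ((r ^ (p + 1) : GLm p 2) : Mat p 2) = (x * x - n * (y * y)) • (1 : Mat p 2) := by
    rw [Units.val_pow_eq_pow_val, pow_succ, hdec, frobenius_pow hp2 hn]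
    rw [sub_mul, mul_add, mul_add, smul_mul_smul, smul_mul_smul, smul_mul_smul, smul_mul_smul,
      one_mul, one_mul, mul_one, singerMat_sq, smul_smul]
    module
  rw [mem_range_scalarHom_iff]
  refine ⟨?_, ?_, ?_⟩ <;> simp [hpow]

/-! ## Non-split type: `|H| ≤ 2 |S_H|` when `p + 1` is a power of two -/

/-- **Non-split law.**  `p ≠ 2`, `p + 1 = 2^k`, `n` a non-square: a subgroup conjugate into
`N(C)` that avoids `-1` has `|H| ≤ 2 |S_H|` (so its projective image has order `≤ 2`). -/
theorem card_le_two_mul_scalar_of_conj_singerNormal (hp2 : p ≠ 2) {k : ℕ} (hk : p + 1 = 2 ^ k)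
    {n : ZMod p} (hn : ∀ x : ZMod p, x * x ≠ n) {H : Subgroup (GLm p 2)} {g : GLm p 2}
    (hg : ∀ x ∈ H, IsSingerNormal n (g * x * g⁻¹)) (hneg : scalarHom p 2 (-1) ∉ H) :
    Nat.card H ≤ 2 * Nat.card (H.comap (scalarHom p 2)) := by
  classical
  set H' := H.map (MulAut.conj g).toMonoidHom with hH'
  have hmem : ∀ y, y ∈ H' ↔ g⁻¹ * y * g ∈ H := fun y => mem_map_conj_iff'
  have hH'N : ∀ y ∈ H', IsSingerNormal n y := by
    intro y hy
    have e : y = g * (g⁻¹ * y * g) * g⁻¹ := by group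
    have h := hg _ ((hmem y).mp hy)
    rw [← e] at h
    exact h
  have hneg' : scalarHom p 2 (-1) ∉ H' := neg_one_not_mem_map_conj g hneg
  -- R = H' ∩ C has odd order
  set R : Subgroup (GLm p 2) := H' ⊓ singerPlusSubgroup n with hR
  have hRodd : Odd (Nat.card R) := by
    by_contra hev
    rw [Nat.not_odd_iff_even, even_iff_two_dvd] at hev
    obtain ⟨r, hr⟩ := exists_prime_orderOf_dvd_card' 2 hev
    have hr2 : ((r : GLm p 2)) * (r : GLm p 2) = 1 := by
      have h := pow_orderOf_eq_one r
      rw [hr] at h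
      have h' := congrArg (fun x : R => (x : GLm p 2)) h
      simpa [pow_two] using h'
    have hr1 : (r : GLm p 2) ≠ 1 := by
      intro h
      have : r = 1 := Subtype.ext h
      rw [this, orderOf_one] at hr
      exact absurd hr (by norm_num)
    obtain ⟨hrH, hrC⟩ := Subgroup.mem_inf.mp r.2
    rcases singerPlus_involution hp2 hn (mem_singerPlusSubgroup.mp hrC) hr2 with h | h
    · exact hr1 h
    · exact hneg' (h ▸ hrH)
  -- the projective image Q of R is a 2-group, hence trivial
  set Q := R.map (QuotientGroup.mk' (scalarHom p 2).range) with hQ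
  have hQ2 : IsPGroup 2 Q := by
    intro q
    refine ⟨k, ?_⟩
    obtain ⟨_, ⟨r, hrR, rfl⟩⟩ := q
    apply Subtype.ext
    change (QuotientGroup.mk' (scalarHom p 2).range r) ^ (2 ^ k) = 1
    rw [← map_pow, ← hk, QuotientGroup.mk'_apply, QuotientGroup.eq_one_iff]
    obtain ⟨_, hrC⟩ := Subgroup.mem_inf.mp hrR
    exact frobenius_singerPlus hp2 hn (mem_singerPlusSubgroup.mp hrC)
  obtain ⟨j, hj⟩ := hQ2.exists_card_eq
  have hRcard : Nat.card R = Nat.card (R.comap (scalarHom p 2)) * Nat.card Q :=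
    card_eq_scalar_mul_card_image R
  have hj0 : j = 0 := by
    by_contra hj0
    have h2 : 2 ∣ Nat.card R := by
      rw [hRcard, hj]
      exact Dvd.dvd.mul_left (dvd_pow_self 2 hj0) _
    exact (Nat.not_even_iff_odd.mpr hRodd) (even_iff_two_dvd.mpr h2)
  rw [hj0, pow_zero] at hj
  rw [hj, mul_one] at hRcard
  have hRle : Nat.card R ≤ Nat.card (H'.comap (scalarHom p 2)) := by
    rw [hRcard]
    exact Subgroup.card_le_of_le (Subgroup.comap_mono inf_le_left)
  have hidx : Nat.card H' ≤ 2 * Nat.card R := card_le_two_mul_card_inf_plus hH'N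
  rw [← card_map_conj_eq H g, ← comap_scalarHom_map_conj H g]
  exact hidx.trans (Nat.mul_le_mul_left 2 hRle)

end SingerFrobenius

end Summit.MatrixMultiplication.MatrixMultiplication.Theorems.SubgroupIdentityDesigns.Negative

end
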